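import Literature.NumberTheory.Automorphic.AshSmithTheoryHeckeCharpolyProofs
import Mathlib.LinearAlgebra.Matrix.SchurComplement
import Mathlib.Algebra.Polynomial.Laurent
import HarnessLib

/-!
# Block cyclic shifts and induced block matrices — helper (1/2) for stub `stub_totallyRealInduction`
of line `one-transparent-pane` (crux `Summit.Langlands.Langlands.Theses.QuadraticWindow.HostInducedRep`,
item stmt-Langlands-10902)

Pure matrix algebra over a commutative ring `B`, sorry-free, no definitions (one local notation).
The tree computes `det(X - Ind(χ)(g))` for a CHARACTER `χ`
(`Literature.NumberTheory.Automorphic.Ash2003.charpoly_indMatrix_eq_prod`); the induced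
representation `Ind_{Γ_F}^{Γ_{F₀}}(ρ_π ⊗ ẽψ⁻¹)` of the stub has BLOCKS of size `n`, and this file
supplies the two matrix identities the block version needs:

* `charpoly_cycShift`: the `f × f` block matrix `S_f(N)` with identity `n × n` blocks on the
  subdiagonal and the block `N` in the upper right corner (multiplication by `Y` on `Bⁿ[Y]/(Y^f = N)`)
  has `det(X - S_f(N)) = det(X^f - N)`, i.e. `charpoly S_f(N) = expand f (charpoly N)`.  Proof
  (`det_sub_cycShift_succ`): block Gaussian elimination along the first block row — the Schur
  complement of the block `y` (Mathlib `Matrix.det_fromBlocks_one₁₁`) gives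
  `det(y - S_{f+1}(N)) = yⁿ · det(y - S_f(y⁻¹N))` for a unit `y`, whence `det(y - S_f(N)) = det(y^f - N)`
  by induction on `f`; for `y = X` pass to Laurent polynomials `B[X] ↪ B[X, X⁻¹]`, where `X` is a unit.
  (For `f = 2` this is `charpoly [[0, N], [1, 0]] = (charpoly N)(X²)`, the inert-place identity of
  `Cruxes/HostInducedRep/Disproof.lean` §4; `f = 1` is the split place.)
* `charpoly_comp_blockDiagonal`: flattened block diagonal matrices (from `Ash2003.charpoly_blockDiagonal`).
* `charpoly_comp_indMatrix_eq_of_transversal`: the characteristic polynomial of the flattened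
  `Ind(π)(g)` (`Literature.NumberTheory.GaloisRepresentations.indMatrix`, Serre's matrix form) does
  not depend on the transversal, for a matrix-valued `π : H →* M_n(B)` (block version of
  `Ash2003.charpoly_indMatrix_eq_of_transversal`).

Companions: `QuadraticWindowHostInducedRepInducedCharpoly.lean` (2/2: `det(X - Ind(π)(g)) =
∏_k det(X^f - π(s_k))` and the Frobenius polynomial of `Ind_{Γ_F}^{Γ_K} ρ` in every rank) and
`QuadraticWindowHostInducedRepTotallyRealInduction.lean` (the stub).

References: J.-P. Serre, *Linear representations of finite groups*, GTM 42 (1977), §3.3 (Thm. 11,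
Thm. 12 and proof), §7.3 Prop. 22 [SerreLinearRepresentations1977]; J. Neukirch, *Algebraic Number
Theory* (1999), VII §10, proof of (10.4) (iv) [NeukirchANT1999].
-/

set_option linter.dupNamespace false -- project-wide option (lakefile weak.linter.dupNamespace); `Summit.Langlands.Langlands` is the mandated namespace

noncomputable section

open Polynomial

namespace Summit.Langlands.Langlands.Theorems.HostInducedRep.OneTransparentPane

/-! ### The block cyclic shift `S_f(N)` and its characteristic polynomial -/

section Blocks

variable {B : Type*} [CommRing B] {n : ℕ}

/-- `cycShift[f, N] = S_f(N)`: the `f × f` block matrix with identity `n × n` blocks on the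
subdiagonal, the block `N` in the corner `(0, f-1)` and `0` elsewhere, flattened (`Matrix.comp`) to a
`B`-matrix indexed by `Fin f × Fin n` (local notation; `n` is the section's block size). -/
local notation3 "cycShift[" f ", " N "]" =>
  Matrix.comp (Fin f) (Fin f) (Fin n) (Fin n) _
    (Matrix.of fun (i : Fin f) (j : Fin f) =>
      if (i : ℕ) = (j : ℕ) + 1 then (1 : Matrix (Fin n) (Fin n) _)
      else if (j : ℕ) + 1 = f ∧ (i : ℕ) = 0 then N else 0)

/-- Entries of the block cyclic shift `S_f(N)`. [folklore] -/
theorem cycShift_apply (f : ℕ) (N : Matrix (Fin n) (Fin n) B) (t t' : Fin f) (a b : Fin n) :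
    (cycShift[f, N] : Matrix _ _ B) (t, a) (t', b) =
      if (t : ℕ) = t' + 1 then (if a = b then 1 else 0)
      else if (t' : ℕ) + 1 = f ∧ (t : ℕ) = 0 then N a b else 0 := by
  simp only [Matrix.comp_apply, Matrix.of_apply]
  split_ifs <;> simp_all [Matrix.one_apply]

/-- A ring homomorphism applied entrywise to `S_f(N)` gives `S_f` of the image of `N`. [folklore] -/
theorem cycShift_map {B' : Type*} [CommRing B'] (g : B →+* B') (f : ℕ)
    (N : Matrix (Fin n) (Fin n) B) :
    (cycShift[f, N] : Matrix _ _ B).map g = (cycShift[f, N.map g] : Matrix _ _ B') := by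
  ext ⟨t, a⟩ ⟨t', b⟩
  rw [Matrix.map_apply, cycShift_apply, cycShift_apply]
  split_ifs <;> simp

/-- **`det (y - S_{f+1}(N)) = det (y^{f+1} - N)` for a unit `y`**, by induction on `f`: reindexing
along `Fin n ⊕ (Fin (f+1) × Fin n) ≃ Fin (f+2) × Fin n` (first block row and column first) writes
`y - S_{f+2}(N)` as the block matrix `[[y, (0 … 0 -N)], [(-1 0 … 0)ᵀ, y - S_{f+1}(0)]]`; factoring
`diag(y, 1)` out of the first block row (`Matrix.det_fromBlocks_one₁₁`) leaves the Schur complement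
`y - S_{f+1}(0) - (-1 0 … 0)ᵀ y⁻¹ (0 … 0 -N) = y - S_{f+1}(y⁻¹ N)`, and
`det(y) · det(y^{f+1} - y⁻¹N) = det(y^{f+2} - N)`. [folklore] -/
theorem det_sub_cycShift_succ (u : Bˣ) : ∀ (f : ℕ) (N : Matrix (Fin n) (Fin n) B),
    ((u : B) • (1 : Matrix _ _ B) - cycShift[f + 1, N]).det =
      ((u : B) ^ (f + 1) • (1 : Matrix _ _ B) - N).det
  | 0, N => by
      have h : ((u : B) • (1 : Matrix _ _ B) - cycShift[1, N]).submatrix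
          (Equiv.uniqueProd (Fin n) (Fin 1)).symm (Equiv.uniqueProd (Fin n) (Fin 1)).symm =
            (u : B) ^ (0 + 1) • (1 : Matrix _ _ B) - N := by
        ext a b
        rw [Matrix.submatrix_apply, Equiv.uniqueProd_symm_apply, Equiv.uniqueProd_symm_apply,
          Matrix.sub_apply, Matrix.sub_apply, Matrix.smul_apply, Matrix.smul_apply, cycShift_apply,
          zero_add, pow_one, Matrix.one_apply, Matrix.one_apply]
        simp [Fin.val_eq_zero, Prod.ext_iff]
      rw [← h, Matrix.det_submatrix_equiv_self]
  | f + 1, N => by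
      have IH := det_sub_cycShift_succ u f ((↑u⁻¹ : B) • N)
      set M := (u : B) • (1 : Matrix _ _ B) - cycShift[f + 1 + 1, N] with hM
      set D := (u : B) • (1 : Matrix _ _ B) - cycShift[f + 1, (0 : Matrix (Fin n) (Fin n) B)] with hD
      set Bm : Matrix (Fin n) (Fin (f + 1) × Fin n) B :=
        Matrix.of fun a q => if (q.1 : ℕ) + 1 = f + 1 then -N a q.2 else 0 with hBm
      set Cm : Matrix (Fin (f + 1) × Fin n) (Fin n) B :=
        Matrix.of fun q b => if (q.1 : ℕ) = 0 ∧ q.2 = b then -1 else 0 with hCm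
      -- reindexing `Fin n ⊕ (Fin (f+1) × Fin n) ≃ Fin (f+2) × Fin n`: first block row and column first
      let e : Fin n ⊕ (Fin (f + 1) × Fin n) ≃ Fin (f + 1 + 1) × Fin n :=
        ⟨Sum.elim (fun a => (0, a)) (fun q => (q.1.succ, q.2)),
          fun p => if h : p.1 = 0 then Sum.inl p.2 else Sum.inr (p.1.pred h, p.2),
          by rintro (a | ⟨t, a⟩) <;> simp [Fin.succ_ne_zero],
          by rintro ⟨t, a⟩; by_cases h : t = 0 <;> [(subst h; simp); simp [h]]⟩
      have hdec : M.submatrix e e = Matrix.fromBlocks ((u : B) • (1 : Matrix _ _ B)) Bm Cm D := by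
        ext (a | ⟨t, a⟩) (b | ⟨t', b⟩)
        · change M (0, a) (0, b) = ((u : B) • (1 : Matrix (Fin n) (Fin n) B)) a b
          rw [hM, Matrix.sub_apply, Matrix.smul_apply, Matrix.smul_apply, cycShift_apply]
          have h1 : ¬ (((0 : Fin (f + 1 + 1)) : ℕ) = ((0 : Fin (f + 1 + 1)) : ℕ) + 1) := by simp
          have h2 : ¬ ((((0 : Fin (f + 1 + 1)) : ℕ) + 1 = f + 1 + 1) ∧
              (((0 : Fin (f + 1 + 1)) : ℕ) = 0)) := by
            simp
          rw [if_neg h1, if_neg h2, sub_zero, Matrix.one_apply, Matrix.one_apply]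
          by_cases hab : a = b
          · subst hab; simp
          · simp [hab]
        · change M (0, a) (Fin.succ t', b) = Bm a (t', b)
          rw [hM, Matrix.sub_apply, Matrix.smul_apply, cycShift_apply, hBm, Matrix.of_apply]
          simp only [Fin.val_succ, Fin.val_zero]
          have h1 : ¬ (0 = (t' : ℕ) + 1 + 1) := by omega
          rw [if_neg h1, Matrix.one_apply,
            if_neg (show ¬ ((0 : Fin (f + 1 + 1)), a) = (Fin.succ t', b) from
              fun h => Fin.succ_ne_zero t' (Prod.mk.inj h).1.symm)]
          by_cases ht : (t' : ℕ) + 1 = f + 1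
          · rw [if_pos ⟨by omega, trivial⟩, if_pos ht, smul_zero, zero_sub]
          · rw [if_neg (fun h => ht (by omega)), if_neg ht, smul_zero, sub_zero]
        · change M (Fin.succ t, a) (0, b) = Cm (t, a) b
          rw [hM, Matrix.sub_apply, Matrix.smul_apply, cycShift_apply, hCm, Matrix.of_apply]
          simp only [Fin.val_succ, Fin.val_zero]
          rw [Matrix.one_apply,
            if_neg (show ¬ ((Fin.succ t, a) = ((0 : Fin (f + 1 + 1)), b)) from
              fun h => Fin.succ_ne_zero t (Prod.mk.inj h).1),
            smul_zero, zero_sub]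
          by_cases ht : (t : ℕ) = 0
          · rw [if_pos (show (t : ℕ) + 1 = 0 + 1 by omega)]
            by_cases hab : a = b
            · subst hab; simp [ht]
            · simp [ht, hab]
          · rw [if_neg (show ¬ ((t : ℕ) + 1 = 0 + 1) by omega),
              if_neg (show ¬ ((0 + 1 = f + 1 + 1) ∧ ((t : ℕ) + 1 = 0)) by omega),
              if_neg (fun h => ht h.1), neg_zero]
        · change M (Fin.succ t, a) (Fin.succ t', b) = D (t, a) (t', b)
          rw [hM, hD, Matrix.sub_apply, Matrix.sub_apply, Matrix.smul_apply, Matrix.smul_apply,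
            cycShift_apply, cycShift_apply]
          simp only [Fin.val_succ]
          have e1 : ((t : ℕ) + 1 = (t' : ℕ) + 1 + 1) ↔ ((t : ℕ) = t' + 1) := by omega
          have e2 : ¬ (((t' : ℕ) + 1 + 1 = f + 1 + 1) ∧ ((t : ℕ) + 1 = 0)) := by omega
          have e3 : ((Fin.succ t, a) = (Fin.succ t', b)) ↔ ((t, a) = (t', b)) := by
            simp [Prod.ext_iff, Fin.succ_inj]
          simp only [Matrix.one_apply, e3, if_neg e2]
          by_cases ht : (t : ℕ) = t' + 1
          · rw [if_pos (e1.mpr ht), if_pos ht]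
          · rw [if_neg (fun h => ht (e1.mp h)), if_neg ht]
            split_ifs <;> simp
      -- the Schur complement of the block `y`
      have hCB : ∀ (t : Fin (f + 1)) (a : Fin n) (t' : Fin (f + 1)) (b : Fin n),
          (Cm * ((↑u⁻¹ : B) • Bm)) (t, a) (t', b) =
            if (t : ℕ) = 0 ∧ (t' : ℕ) + 1 = f + 1 then ((↑u⁻¹ : B) • N) a b else 0 := by
        intro t a t' b
        rw [Matrix.mul_apply]
        simp only [hBm, hCm, Matrix.of_apply, Matrix.smul_apply]
        by_cases ht : (t : ℕ) = 0
        · by_cases ht' : (t' : ℕ) + 1 = f + 1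
          · simp [ht, ht']
          · simp [ht]
        · simp [ht]
      have hschur : D - Cm * ((↑u⁻¹ : B) • Bm) =
          (u : B) • (1 : Matrix _ _ B) - cycShift[f + 1, (↑u⁻¹ : B) • N] := by
        ext ⟨t, a⟩ ⟨t', b⟩
        rw [Matrix.sub_apply, hCB, hD, Matrix.sub_apply, Matrix.sub_apply, cycShift_apply,
          cycShift_apply]
        by_cases h1 : (t : ℕ) = t' + 1
        · rw [if_pos h1, if_pos h1, if_neg (show ¬ ((t : ℕ) = 0 ∧ (t' : ℕ) + 1 = f + 1) by omega),
            sub_zero]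
        · rw [if_neg h1, if_neg h1]
          by_cases h2 : (t' : ℕ) + 1 = f + 1 ∧ (t : ℕ) = 0
          · rw [if_pos h2, if_pos h2, if_pos ⟨h2.2, h2.1⟩, Matrix.zero_apply, sub_zero]
          · rw [if_neg h2, if_neg h2, if_neg (fun h => h2 ⟨h.2, h.1⟩), sub_zero]
      -- factor `diag(y, 1)` out of the first block row and take determinants
      have hfac : Matrix.fromBlocks ((u : B) • (1 : Matrix _ _ B)) Bm Cm D =
          Matrix.fromBlocks ((u : B) • (1 : Matrix _ _ B)) 0 0 (1 : Matrix _ _ B) *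
            Matrix.fromBlocks 1 ((↑u⁻¹ : B) • Bm) Cm D := by
        rw [Matrix.fromBlocks_multiply]
        simp [smul_smul]
      rw [← Matrix.det_submatrix_equiv_self e M, hdec, hfac, Matrix.det_mul,
        Matrix.det_fromBlocks_zero₂₁, Matrix.det_one, mul_one, Matrix.det_fromBlocks_one₁₁, hschur,
        IH, ← Matrix.det_mul]
      congr 1
      rw [Matrix.smul_mul, Matrix.one_mul, smul_sub, smul_smul, smul_smul, ← pow_succ',
        Units.mul_inv, one_smul]

/-- **The characteristic polynomial of the block cyclic shift**: for `0 < f`,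
`det(X - S_f(N)) = det(X^f - N)`, i.e. `charpoly S_f(N) = expand f (charpoly N)`.  Proof: in Laurent
polynomials `X` is a unit, so `det_sub_cycShift_succ` applies; `B[X] → B[X, X⁻¹]` is injective
(Mathlib `Polynomial.toLaurent_injective`). [folklore] -/
theorem charpoly_cycShift {f : ℕ} (hf : 0 < f) (N : Matrix (Fin n) (Fin n) B) :
    (cycShift[f, N] : Matrix _ _ B).charpoly = expand B f N.charpoly := by
  obtain ⟨f, rfl⟩ : ∃ f', f = f' + 1 := ⟨f - 1, by omega⟩
  apply Polynomial.toLaurent_injective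
  obtain ⟨u, hu⟩ := LaurentPolynomial.isUnit_T (R := B) 1
  set g : B →+* LaurentPolynomial B := Polynomial.toLaurent.comp Polynomial.C with hg
  have hL : Polynomial.toLaurent (cycShift[f + 1, N] : Matrix _ _ B).charpoly =
      ((u : LaurentPolynomial B) • (1 : Matrix _ _ (LaurentPolynomial B)) -
        cycShift[f + 1, N.map g]).det := by
    rw [Matrix.charpoly, RingHom.map_det, RingHom.mapMatrix_apply]
    congr 1
    refine Matrix.ext fun i j => ?_
    rw [Matrix.map_apply, Matrix.charmatrix_apply, map_sub, Matrix.sub_apply, Matrix.smul_apply,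
      ← cycShift_map, Matrix.map_apply, smul_eq_mul]
    congr 1
    rw [Matrix.diagonal_apply, Matrix.one_apply, hu, mul_ite, mul_one, mul_zero]
    split_ifs
    · exact Polynomial.toLaurent_X
    · exact map_zero _
  have hR : Polynomial.toLaurent (expand B (f + 1) N.charpoly) =
      ((u : LaurentPolynomial B) ^ (f + 1) • (1 : Matrix _ _ (LaurentPolynomial B)) - N.map g).det := by
    have h1 : Polynomial.toLaurent (expand B (f + 1) N.charpoly) =
        (Polynomial.toLaurent.comp (expand B (f + 1) : B[X] →+* B[X])) N.charmatrix.det := by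
      rw [Matrix.charpoly, RingHom.comp_apply, RingHom.coe_coe]
    rw [h1, RingHom.map_det, RingHom.mapMatrix_apply]
    congr 1
    refine Matrix.ext fun i j => ?_
    rw [Matrix.map_apply, RingHom.comp_apply, RingHom.coe_coe, Matrix.charmatrix_apply, map_sub,
      map_sub, expand_C, Matrix.sub_apply, Matrix.smul_apply, Matrix.map_apply, smul_eq_mul]
    congr 1
    rw [Matrix.diagonal_apply, Matrix.one_apply, hu, mul_ite, mul_one, mul_zero]
    split_ifs
    · rw [expand_X, Polynomial.toLaurent_X_pow, LaurentPolynomial.T_pow, mul_one]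
    · rw [map_zero, map_zero]
  rw [hL, hR, det_sub_cycShift_succ]

/-- **The characteristic polynomial of a flattened block diagonal matrix is the product of those
of its flattened blocks** (reindex to a block diagonal matrix of flattened blocks;
`Ash2003.charpoly_blockDiagonal`). [folklore] -/
theorem charpoly_comp_blockDiagonal {κ m o : Type*} [Fintype κ] [DecidableEq κ] [Fintype m]
    [DecidableEq m] [Fintype o] [DecidableEq o] (M : κ → Matrix m m (Matrix o o B)) :
    (Matrix.comp (m × κ) (m × κ) o o B (Matrix.blockDiagonal M)).charpoly =
      ∏ k, (Matrix.comp m m o o B (M k)).charpoly := by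
  let e : (m × κ) × o ≃ (m × o) × κ :=
    ⟨fun p => ((p.1.1, p.2), p.1.2), fun q => ((q.1.1, q.2), q.1.2), fun _ => rfl, fun _ => rfl⟩
  have h : Matrix.reindex e e (Matrix.comp (m × κ) (m × κ) o o B (Matrix.blockDiagonal M)) =
      Matrix.blockDiagonal fun k => Matrix.comp m m o o B (M k) := by
    ext ⟨⟨t, a⟩, k⟩ ⟨⟨t', b⟩, k'⟩
    simp only [Matrix.reindex_apply, Matrix.submatrix_apply, Matrix.comp_apply,
      Matrix.blockDiagonal_apply, e, Equiv.coe_fn_symm_mk]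
    split_ifs <;> rfl
  rw [← Matrix.charpoly_reindex e, h,
    Literature.NumberTheory.Automorphic.Ash2003.charpoly_blockDiagonal]

end Blocks

/-! ### The characteristic polynomial of `Ind(π)(g)` does not depend on the transversal -/

section Induced

variable {H G : Type*} [Group H] [Group G] {B : Type*} [CommRing B] {n : ℕ}

/-- **The characteristic polynomial of the flattened `Ind(π)(g)` does not depend on the
transversal**, for a matrix-valued homomorphism `π : H →* M_n(B)`: two transversals differ by a
relabelling `s` of the cosets and by `r'_k = r_{s k} φ(h_k)`, so
`Ind'(π)(g) = D⁻¹ · Ind(π)(g)^s · D` with the block diagonal `D = diag(π(h_k))`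
(`indMatrix_mul_map_apply`), and the characteristic polynomial of the flattened matrix is invariant
(Mathlib `Matrix.charpoly_mul_comm`, `Matrix.charpoly_reindex`).  Block version of
`Ash2003.charpoly_indMatrix_eq_of_transversal`.
Ref: Serre, *Linear representations of finite groups*, §3.3 Thm. 11. [folklore] -/
theorem charpoly_comp_indMatrix_eq_of_transversal {φ : H →* G} (hφ : Function.Injective φ)
    (π : H →* Matrix (Fin n) (Fin n) B) {ι ι' : Type*} [Fintype ι] [DecidableEq ι] [Fintype ι']
    [DecidableEq ι'] {r : ι → G} {r' : ι' → G}
    (hr : Function.Bijective fun i => (r i : G ⧸ φ.range))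
    (hr' : Function.Bijective fun i => (r' i : G ⧸ φ.range)) (g : G) :
    (Matrix.comp ι' ι' (Fin n) (Fin n) B
        (Literature.NumberTheory.GaloisRepresentations.indMatrix φ π r' g)).charpoly =
      (Matrix.comp ι ι (Fin n) (Fin n) B
        (Literature.NumberTheory.GaloisRepresentations.indMatrix φ π r g)).charpoly := by
  -- adapted from Literature/NumberTheory/Automorphic/AshSmithTheoryHeckeCharpolyProofs.lean
  -- (`Ash2003.charpoly_indMatrix_eq_of_transversal`, characters ↦ blocks)
  set er := Equiv.ofBijective _ hr with her
  set er' := Equiv.ofBijective _ hr' with her'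
  set s : ι' ≃ ι := er'.trans er.symm with hsdef
  have hsk : ∀ k, (r (s k) : G ⧸ φ.range) = (r' k : G ⧸ φ.range) := fun k =>
    er.apply_symm_apply (er' k)
  have hmem : ∀ k, ∃ a, φ a = (r (s k))⁻¹ * r' k := fun k => QuotientGroup.eq.mp (hsk k)
  choose h hh using hmem
  have hr'eq : r' = fun k => r (s k) * φ (h k) := funext fun k => by rw [hh, mul_inv_cancel_left]
  -- block level: `Ind'(π)(g) = D⁻¹ · Ind(π)(g)^s · D`
  have hN' : Literature.NumberTheory.GaloisRepresentations.indMatrix φ π r' g =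
      Matrix.diagonal (fun k => π (h k)⁻¹) *
        (Literature.NumberTheory.GaloisRepresentations.indMatrix φ π r g).submatrix s s *
          Matrix.diagonal (fun k => π (h k)) := by
    ext k k' : 2
    rw [Matrix.mul_diagonal, Matrix.diagonal_mul, Matrix.submatrix_apply, hr'eq,
      Literature.NumberTheory.GaloisRepresentations.indMatrix_mul_map_apply hφ π (fun k => r (s k))
        h g k k']
    rfl
  -- flatten: `comp` is a ring isomorphism, and `comp (M^s) = (comp M)^(s × 1)`
  set cR := Matrix.compRingEquiv ι' (Fin n) B with hcR
  have hcomp : ∀ M : Matrix ι' ι' (Matrix (Fin n) (Fin n) B),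
      Matrix.comp ι' ι' (Fin n) (Fin n) B M = cR M := fun M => rfl
  have hsub : Matrix.comp ι' ι' (Fin n) (Fin n) B
      ((Literature.NumberTheory.GaloisRepresentations.indMatrix φ π r g).submatrix s s) =
      Matrix.reindex (s.prodCongr (Equiv.refl (Fin n))).symm (s.prodCongr (Equiv.refl (Fin n))).symm
        (Matrix.comp ι ι (Fin n) (Fin n) B
          (Literature.NumberTheory.GaloisRepresentations.indMatrix φ π r g)) := by
    ext ⟨k, a⟩ ⟨k', b⟩
    rfl
  have hDD : Matrix.diagonal (fun k => π (h k)) * Matrix.diagonal (fun k => π (h k)⁻¹) =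
      (1 : Matrix ι' ι' (Matrix (Fin n) (Fin n) B)) := by
    rw [Matrix.diagonal_mul_diagonal, ← Matrix.diagonal_one]
    congr 1
    funext k
    rw [← map_mul, mul_inv_cancel, map_one]
  rw [hN', hcomp, map_mul, Matrix.charpoly_mul_comm, ← map_mul, ← mul_assoc, hDD,
    one_mul, ← hcomp, hsub, Matrix.charpoly_reindex]

end Induced

/-- **Registered anchor** of this helper file (stub registry of stmt-Langlands-10902, line
`one-transparent-pane`, chain `stub_totallyRealInduction` 1/3): the flattened block-diagonal
characteristic polynomial identity `charpoly_comp_blockDiagonal` at universe `0`. [folklore] -/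
theorem inducedCharpolyBlocks_anchor : ∀ {B : Type} [CommRing B] {κ m o : Type} [Fintype κ] [DecidableEq κ] [Fintype m] [DecidableEq m] [Fintype o] [DecidableEq o] (M : κ → Matrix m m (Matrix o o B)), (Matrix.comp (m × κ) (m × κ) o o B (Matrix.blockDiagonal M)).charpoly = ∏ k, (Matrix.comp m m o o B (M k)).charpoly :=
  fun M => charpoly_comp_blockDiagonal M

end Summit.Langlands.Langlands.Theorems.HostInducedRep.OneTransparentPane

end
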